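import Summits.QuantumFields.YangMills.Theorems.BalabanUVNodesN08AlphaEq324RowClassSocketAE

/-!
# Route «BalabanUVNodes», Track-A DAG node N08 = [Balaban1985UV3] Thm 1 p. 257 ∕ Thm 2 p. 272 — THE CLASS SOCKET AT EVERY RUN STEP: the `η`-bookkeeping of
# [Balaban1982Higgs1] (3.24) on the WHOLE coupling range `(0, 1]` (not only `η ≤ η₀`), and the (α)-row `h324` of the edited clauses from the class road's sandwich at
# ALL steps `k ≤ K` of every lattice approximation (part 3 of the class socket; parts 1–2 = `…RowClassSocket`, `…RowClassSocketAE`)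

Cell `pub-ymgap`, seat `pub-ymgap-dag-n08-w4` gen 5 (INTENT-4; LOCATED «ALL STEPS», INBOX l.37547).  `bears_on: R4∕N08`; filed `--supports stmt-QuantumFields-27364` (K1⁹, helper).
THEOREMS ONLY (def-free, sorry-free, standard axioms); dag-n08-d's `…Specialisation.errTerm_pFun_le ∕ pFun_rpow_eq ∕ pFun_pos_of_le_one`, `…Eq324Signed.pos_and_abs_log_sub_le_of_sandwich`
and parts 1–2 consumed BY NAME.

WHY.  The edition needs its (3.24) row at EVERY run step (`…RowAC.RunAlphaEq324CoreLTAtAC.steps : ∀ k (hk : k + 1 ≤ S.K), …`), i.e. at every running coupling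
`g_k ∈ (0, g√ε₀] ⊆ (0, 1]` — the lane NORMALISES the smallness threshold to `1` (`Scales.gK_le_one`, `ScalesArithmetic.gk_le_one`; the leaves' O(1)'s absorb print's «g_k sufficiently
small»).  The class road's measure-free consumer `…Eq324Signed.eq324_of_sandwich_consts` — hence parts 1–2 of this socket — serve only `η ≤ η₀`, with `η₀` from `errTerm_pFun_le` (the
large-field term `e^{−ρ₃ p(η)^{3∕2}}` is compared with `η^κ` only for `η` small).  But on `[η₀, 1]` the printed error per unit volume is simply BOUNDED (`b = p(η) ∈ [b₀, p(η₀)]`,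
`A ≤ c·η^σ ≤ c`), so the bookkeeping `errTerm ≤ C·η^κ` holds on ALL of `(0, 1]` with a larger `C` — and `C` is all the (α)-row's booked constant `Ca + Cc` has to dominate.  What is NOT
automatic on the whole range is the supplier's THRESHOLD CONDITION `b* < p(g_k)` (the class lemma speaks only above its free-field constant `b*`): since `p(η) ≥ p(1) = b₀` on `(0,1]`, it
holds at every step iff (essentially) `b* < b₀` — a RECORD-versus-CLASS WINDOW, displayed below as the hypothesis `hbw` (print: (7) p. 257 «b₀ is a sufficiently large absolute
constant»; [BenfattoEtAl1978] p. 159 «b* = max{10⁴, γ⁻³b̄}»; the lane's `AlphaConsts.b₀` is a fixed recipe, so the window is a genuine proviso, like the free numeric window of the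
residual list).
* §1 `rpow_le_rpow_abs_of_le` · ★★ `errTerm_pFun_le_on_unit` — `∃ C ≥ 0, ∀ η ∈ (0, 1], ∀ A ∈ [0, c·η^σ]: errTerm S ρ₁ ρ₂ ρ₃ ρ₄ A (p η) t ≤ C·η^κ` (every `0 < κ < σ(t+1)`).
* §2 ★ `pos_and_abs_log_le_of_sandwich_on_unit` (the class consumer on `(0, 1]`: NO `η₀`, NO `b*`) · `eq324Row_of_sandwich_on_unit` (its `Eq324` form at the free letter) ·
  ★★ `eq324Row_of_sandwich_allSteps` ([B10] currencies at EVERY step `k ≤ K` of EVERY `S`: `η := g_k ≤ 1`, threshold `p(g_k)`, `t := n̄`, `κ := 6 + 2κ₀`, volume factor) · `…_rec_one`;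
  `lt_pFun_of_lt_b₀` (`b* < b₀ ⇒ b* < p(η)` on `(0, 1]`).
* §3 ★★★ `exists_h324Row_freeLetter_of_classSandwich_allSteps_ae` (a.e. presentation; exact = special case) · `…_allSteps_of_forall_gt_ae` (knit form `∀ b > b*`
  under the window `hbw : b* < b₀`) · `…_allSteps_rec_one_ae` — `∃ C ≥ 0` from the class constants and `(n̄, κ₀, σ, b₀, p₀)` ALONE such that for EVERY `S`, `𝔖`, EVERY `k ≤ S.K` and `v`
  with `C·v ≤ Ca + Cc`, the presentation + the per-(h, U) sandwich at `b = p(g_k)` give `StepAlphaEq324CoreLTAtAC.h324` ∕ `StepAlphaEq324CoreLTAt.h324` at the free letter.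
HONEST SCOPE.  Real analysis + bookkeeping over binder shapes; the sandwich, the presentation, the class constants and the window `b* < b₀` are HYPOTHESES (IDENT = class II ∕ NODE 00);
nothing of [Balaban1985UV3] ∕ [BenfattoEtAl1978] asserted or discharged; `PrintedUV3V` NOT proved; N08 NOT discharged; count-neutral; one finite 𝕋⁴ programme at fixed ε, Bałaban AS
PRINTED — R4 closes the conditional finite-𝕋⁴ rung `BalabanLadder.UV` only; nothing continuum ∕ ℝ⁴ ∕ OS ∕ mass gap ∕ Clay.

References: [Balaban1985UV3] T. Bałaban, CMP 102 (1985) 255–275 — (5) p. 256, (7) p. 257, (41) p. 266, (56)–(58) p. 270; [Balaban1982Higgs1] T. Bałaban, CMP 85 (1982) — (3.24) p. 616;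
[BenfattoEtAl1978] G. Benfatto et al., CMP 59 (1978) — Lemma (4.6)–(4.7) p. 152, Remark 4 p. 153, b* p. 159.
-/

noncomputable section

namespace Summit.QuantumFields.YangMills.Theorems.BalabanUVNodesN08AlphaEq324RowClassSocketAllSteps

open MeasureTheory
open scoped BigOperators Nat
open Literature.MathematicalPhysics.QuantumFieldTheory.Balaban1983to89
open Literature.MathematicalPhysics.QuantumFieldTheory.Balaban1983to89.B1Sect3Statements (Eq324)
open Literature.MathematicalPhysics.QuantumFieldTheory.Balaban1983to89.B1Eq324BenfattoLemma
  (Coef hamiltonian coefSup smallFieldSet cutoffBoltzmann truncatedExp cumulantSum errTerm)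
open Literature.MathematicalPhysics.QuantumFieldTheory.Balaban1983to89.B1Eq324BenfattoSpecialisation
  (errTerm_pFun_le pFun_rpow_eq pFun_pos_of_le_one coefSup_nonneg)
open Literature.MathematicalPhysics.QuantumFieldTheory.Balaban1983to89.B1Eq324BenfattoEq324Signed (pos_and_abs_log_sub_le_of_sandwich)
open Literature.MathematicalPhysics.QuantumFieldTheory.Balaban1983to89.B1Eq324CumulantTaylor (eq324_iff_abs_log_sub_le)
open Literature.MathematicalPhysics.QuantumFieldTheory.Balaban1985CMP102.Setting
open Summit.QuantumFields.Balaban3D.Carriers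
open Summit.QuantumFields.Balaban3D.Proofs.ScalesArithmetic (g0sq_pos L_pos sites_nonneg gk_pos gk_le_one)
open Summit.QuantumFields.Balaban3D.Proofs.Primitives (AlphaConsts)
open Summit.QuantumFields.Balaban3D.Proofs.GroupModelLieC (lieC)
open Summit.QuantumFields.YangMills.Theorems.BalabanUVNodesN08AlphaEq324RowSocket (eq324_mono)
open Summit.QuantumFields.YangMills.Theorems.BalabanUVNodesN08AlphaEq324RowCumLetterModel (budget_le_vol gk_rpow_six_add)
open Summit.QuantumFields.YangMills.Theorems.BalabanUVNodesN08AlphaEq324RowClassSocket (integral_cutoffBoltzmann_eq_setIntegral')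
open Summit.QuantumFields.YangMills.Theorems.BalabanUVNodesN08AlphaEq324RowClassSocketAE (h324RowAt_freeLetter_of_latticePresentation_ae)
open Literature.Probability.LatticeModels (cumulantOf)

variable {L : ℕ}

/-! ## §1 The printed error per unit volume on the WHOLE coupling range `(0, 1]` -/

section UnitRange

/-- For `1 ≤ ℓ ≤ ℓ₁` and any real exponent: `ℓ^x ≤ ℓ₁^{|x|}`. [folklore] -/
theorem rpow_le_rpow_abs_of_le {ℓ ℓ₁ : ℝ} (h1 : 1 ≤ ℓ) (h2 : ℓ ≤ ℓ₁) (x : ℝ) : ℓ ^ x ≤ ℓ₁ ^ |x| := by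
  rcases le_or_gt 0 x with hx | hx
  · rw [abs_of_nonneg hx]
    exact Real.rpow_le_rpow (zero_le_one.trans h1) h2 hx
  · calc ℓ ^ x ≤ 1 := Real.rpow_le_one_of_one_le_of_nonpos h1 hx.le
      _ ≤ ℓ₁ ^ |x| := Real.one_le_rpow (h1.trans h2) (abs_nonneg x)

/-- ★★ **THE `η`-BOOKKEEPING OF (3.24) ON THE WHOLE RANGE `(0, 1]`.**  With the coefficient bound `0 ≤ A ≤ c·η^σ` and the threshold `b = p(η) = b₀(1 + log η⁻¹)^{p₀}`, the
printed error per unit volume satisfies `errTerm S ρ₁ ρ₂ ρ₃ ρ₄ A (p η) t ≤ C·η^κ` for ALL `η ∈ (0, 1]` and every `0 < κ < σ(t+1)` (`S ≥ 0`, `ρ₃ > 0`, `b₀ > 0`, `p₀ > 2∕3`, `σ > 0`,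
`c ≥ 0`).  (`errTerm_pFun_le` on `(0, η₀]`; on `[η₀, 1]` the error is bounded — `p(η)^ρ = b₀^ρ(1 + log η⁻¹)^{p₀ρ} ≤ b₀^ρ(1 + log η₀⁻¹)^{|p₀ρ|}`, `A ≤ c`, `e^{−ρ₃ b^{3∕2}} ≤ 1` — and
`η^κ ≥ η₀^κ`.) [cite: Balaban1982Higgs1, (3.24) p.616; BenfattoEtAl1978, (4.6)–(4.7) p.152, Remark 4 p.153] -/
theorem errTerm_pFun_le_on_unit {S ρ₃ b₀ p₀ σ c κ : ℝ} (ρ₁ ρ₂ ρ₄ : ℝ) (t : ℕ) (hS : 0 ≤ S) (hρ₃ : 0 < ρ₃) (hb₀ : 0 < b₀)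
    (hp₀ : 2 / 3 < p₀) (hσ : 0 < σ) (hc : 0 ≤ c) (hκ : 0 < κ) (hκσ : κ < σ * (t + 1)) :
    ∃ C : ℝ, 0 ≤ C ∧ ∀ η A : ℝ, 0 < η → η ≤ 1 → 0 ≤ A → A ≤ c * η ^ σ →
      errTerm S ρ₁ ρ₂ ρ₃ ρ₄ A (B10.pFun b₀ p₀ η) t ≤ C * η ^ κ := by
  obtain ⟨η₀, C₀, hη₀, hη₀1, hC₀, h₀⟩ := errTerm_pFun_le ρ₁ ρ₂ ρ₄ t hS hρ₃ hb₀ hp₀ hσ hc hκ hκσ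
  -- constants for the range `η ∈ [η₀, 1]`
  set ℓ₁ : ℝ := 1 + Real.log η₀⁻¹ with hℓ₁
  have hℓ₁1 : 1 ≤ ℓ₁ := by rw [hℓ₁]; linarith [B10.log_inv_nonneg_of_le_one hη₀ hη₀1]
  have hℓ₁0 : 0 < ℓ₁ := lt_of_lt_of_le one_pos hℓ₁1
  have hb1 : 0 < b₀ ^ ρ₁ := Real.rpow_pos_of_pos hb₀ _
  have hb3 : 0 < b₀ ^ ρ₃ := Real.rpow_pos_of_pos hb₀ _
  have hl1 : 0 < ℓ₁ ^ |p₀ * ρ₁| := Real.rpow_pos_of_pos hℓ₁0 _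
  have hl3 : 0 < ℓ₁ ^ |p₀ * ρ₃| := Real.rpow_pos_of_pos hℓ₁0 _
  set B₁ : ℝ := b₀ ^ ρ₁ * ℓ₁ ^ |p₀ * ρ₁| with hB₁
  set B₃ : ℝ := b₀ ^ ρ₃ * ℓ₁ ^ |p₀ * ρ₃| with hB₃
  have hB₁0 : 0 ≤ B₁ := (mul_pos hb1 hl1).le
  have hB₃0 : 0 ≤ B₃ := (mul_pos hb3 hl3).le
  set G : ℝ := c * B₃ with hG
  have hG0 : 0 ≤ G := mul_nonneg hc hB₃0
  set M₁ : ℝ := c * B₁ * Real.exp (|ρ₂| * G) with hM₁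
  have hM₁0 : 0 ≤ M₁ := mul_nonneg (mul_nonneg hc hB₁0) (Real.exp_pos _).le
  set M : ℝ := S * (M₁ ^ (t + 1) + Real.exp (|ρ₄| * G)) with hM
  have hM0 : 0 ≤ M := mul_nonneg hS (add_nonneg (pow_nonneg hM₁0 _) (Real.exp_pos _).le)
  have hηκ : 0 < η₀ ^ κ := Real.rpow_pos_of_pos hη₀ κ
  refine ⟨C₀ + M / η₀ ^ κ, add_nonneg hC₀ (div_nonneg hM0 hηκ.le), fun η A hη hη1 hA hAc => ?_⟩
  have hηκ' : 0 ≤ η ^ κ := Real.rpow_nonneg hη.le κ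
  rcases le_or_gt η η₀ with hle | hgt
  · calc errTerm S ρ₁ ρ₂ ρ₃ ρ₄ A (B10.pFun b₀ p₀ η) t ≤ C₀ * η ^ κ := h₀ η A hη hle hA hAc
      _ ≤ (C₀ + M / η₀ ^ κ) * η ^ κ := mul_le_mul_of_nonneg_right (le_add_of_nonneg_right (div_nonneg hM0 hηκ.le)) hηκ'
  · -- the bounded range `η₀ < η ≤ 1`
    have hM' : errTerm S ρ₁ ρ₂ ρ₃ ρ₄ A (B10.pFun b₀ p₀ η) t ≤ M := by
      set ℓ : ℝ := 1 + Real.log η⁻¹ with hℓ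
      have hℓ1 : 1 ≤ ℓ := by rw [hℓ]; linarith [B10.log_inv_nonneg_of_le_one hη hη1]
      have hℓℓ₁ : ℓ ≤ ℓ₁ := by
        have : Real.log η⁻¹ ≤ Real.log η₀⁻¹ := by
          rw [Real.log_inv, Real.log_inv]
          exact neg_le_neg (Real.log_le_log hη₀ hgt.le)
        rw [hℓ, hℓ₁]
        linarith
      set b : ℝ := B10.pFun b₀ p₀ η with hbdef
      have hbpos : 0 < b := pFun_pos_of_le_one hb₀ hη hη1
      have hbρ : ∀ ρ : ℝ, b ^ ρ ≤ b₀ ^ ρ * ℓ₁ ^ |p₀ * ρ| := fun ρ => by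
        rw [hbdef, pFun_rpow_eq hb₀ hη hη1 ρ]
        exact mul_le_mul_of_nonneg_left (rpow_le_rpow_abs_of_le hℓ1 hℓℓ₁ _) (Real.rpow_nonneg hb₀.le _)
      have hAc' : A ≤ c := hAc.trans (mul_le_of_le_one_right hc (Real.rpow_le_one hη.le hη1 hσ.le))
      have hAb3 : A * b ^ ρ₃ ≤ G := mul_le_mul hAc' (hbρ ρ₃) (Real.rpow_nonneg hbpos.le _) hc
      have hAb1 : A * b ^ ρ₁ ≤ c * B₁ := mul_le_mul hAc' (hbρ ρ₁) (Real.rpow_nonneg hbpos.le _) hc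
      have hAb30 : 0 ≤ A * b ^ ρ₃ := mul_nonneg hA (Real.rpow_nonneg hbpos.le _)
      have hAb10 : 0 ≤ A * b ^ ρ₁ := mul_nonneg hA (Real.rpow_nonneg hbpos.le _)
      have hexp : ∀ ρ : ℝ, Real.exp (ρ * A * b ^ ρ₃) ≤ Real.exp (|ρ| * G) := fun ρ => by
        apply Real.exp_le_exp.mpr
        calc ρ * A * b ^ ρ₃ = ρ * (A * b ^ ρ₃) := by ring
          _ ≤ |ρ| * (A * b ^ ρ₃) := mul_le_mul_of_nonneg_right (le_abs_self _) hAb30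
          _ ≤ |ρ| * G := mul_le_mul_of_nonneg_left hAb3 (abs_nonneg _)
      have hbase : A * b ^ ρ₁ * Real.exp (ρ₂ * A * b ^ ρ₃) ≤ M₁ :=
        mul_le_mul hAb1 (hexp ρ₂) (Real.exp_pos _).le (mul_nonneg hc hB₁0)
      have hbase0 : 0 ≤ A * b ^ ρ₁ * Real.exp (ρ₂ * A * b ^ ρ₃) := mul_nonneg hAb10 (Real.exp_pos _).le
      have hpow : (A * b ^ ρ₁ * Real.exp (ρ₂ * A * b ^ ρ₃)) ^ (t + 1) ≤ M₁ ^ (t + 1) := pow_le_pow_left₀ hbase0 hbase _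
      have hT2 : Real.exp (-(ρ₃ * b ^ (3 / 2 : ℝ))) * Real.exp (ρ₄ * A * b ^ ρ₃) ≤ Real.exp (|ρ₄| * G) := by
        have h32 : 0 ≤ b ^ (3 / 2 : ℝ) := Real.rpow_nonneg hbpos.le _
        have h1 : Real.exp (-(ρ₃ * b ^ (3 / 2 : ℝ))) ≤ 1 :=
          Real.exp_le_one_iff.mpr (by have := mul_nonneg hρ₃.le h32; linarith)
        calc Real.exp (-(ρ₃ * b ^ (3 / 2 : ℝ))) * Real.exp (ρ₄ * A * b ^ ρ₃) ≤ 1 * Real.exp (|ρ₄| * G) :=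
              mul_le_mul h1 (hexp ρ₄) (Real.exp_pos _).le zero_le_one
          _ = Real.exp (|ρ₄| * G) := one_mul _
      rw [hM]
      unfold errTerm
      exact mul_le_mul_of_nonneg_left (add_le_add hpow hT2) hS
    have hηη₀ : η₀ ^ κ ≤ η ^ κ := Real.rpow_le_rpow hη₀.le hgt.le hκ.le
    calc errTerm S ρ₁ ρ₂ ρ₃ ρ₄ A (B10.pFun b₀ p₀ η) t ≤ M := hM'
      _ = M / η₀ ^ κ * η₀ ^ κ := (div_mul_cancel₀ M hηκ.ne').symm
      _ ≤ M / η₀ ^ κ * η ^ κ := mul_le_mul_of_nonneg_left hηη₀ (div_nonneg hM0 hηκ.le)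
      _ ≤ (C₀ + M / η₀ ^ κ) * η ^ κ := mul_le_mul_of_nonneg_right (le_add_of_nonneg_left hC₀) hηκ'

/-- **The threshold window**: if the class constant `b*` is below the record's `b₀ > 0` (`p₀ ≥ 0`), then `b* < p(η)` for EVERY `η ∈ (0, 1]` (`p(η) ≥ b₀·1`).  Print: (7) p. 257
«b₀ is a sufficiently large absolute constant»; [2] p. 159 «b* = max{10⁴, γ⁻³b̄}». [cite: Balaban1985UV3, (7) p.257; BenfattoEtAl1978, p.159] -/
theorem lt_pFun_of_lt_b₀ {bstar b₀ p₀ η : ℝ} (hbw : bstar < b₀) (hb₀ : 0 < b₀) (hp₀ : 0 ≤ p₀) (hη : 0 < η) (hη1 : η ≤ 1) :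
    bstar < B10.pFun b₀ p₀ η := by
  unfold B10.pFun
  have hu : 1 ≤ 1 + Real.log η⁻¹ := by linarith [B10.log_inv_nonneg_of_le_one hη hη1]
  have h1 : 1 ≤ (1 + Real.log η⁻¹) ^ p₀ := Real.one_le_rpow hu hp₀
  calc bstar < b₀ := hbw
    _ = b₀ * 1 := (mul_one _).symm
    _ ≤ b₀ * (1 + Real.log η⁻¹) ^ p₀ := mul_le_mul_of_nonneg_left h1 hb₀.le

end UnitRange

/-! ## §2 The class consumer and its `Eq324` form on `(0, 1]`; [B10] currencies at EVERY run step -/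

section Consumer

variable {d : ℕ}

/-- ★ **THE CLASS ROAD's MEASURE-FREE CONSUMER ON THE WHOLE RANGE `(0, 1]`** (no `η₀`, no `b*`): `∃ C ≥ 0` from `(t, S, ρ₁…ρ₄, b₀, p₀, σ, c, κ)` such that for every `η ∈ (0, 1]`,
every measure `μ`, every instance with `sup|coeff| ≤ c·η^σ`, the two-sided sandwich at `b = p(η)` gives `0 < ∫Πχ̂_{p(η)}e^{H_J}dμ` and `|log ∫ − cumulantSum μ H_J t| ≤ C·η^κ·|I|`.
(`errTerm_pFun_le_on_unit` + `pos_and_abs_log_sub_le_of_sandwich`.) [cite: Balaban1982Higgs1, (3.24) p.616; BenfattoEtAl1978, Lemma p.152, Remark 4 p.153] -/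
theorem pos_and_abs_log_le_of_sandwich_on_unit {t D : ℕ} {ϰ Sc ρ₁ ρ₂ ρ₃ ρ₄ b₀ p₀ σ c κ : ℝ}
    (hS : 0 ≤ Sc) (hρ₃ : 0 < ρ₃) (hb₀ : 0 < b₀) (hp₀ : 2 / 3 < p₀) (hσ : 0 < σ) (hc : 0 ≤ c) (hκ : 0 < κ) (hκσ : κ < σ * (t + 1)) :
    ∃ C : ℝ, 0 ≤ C ∧ ∀ η : ℝ, 0 < η → η ≤ 1 →
      ∀ (μ : Measure ((Fin d → ℤ) → ℝ)) (s : ℕ) (I J : Finset (Fin d → ℤ)) (a : Coef d), coefSup s D a J ≤ c * η ^ σ →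
        Real.exp (cumulantSum μ (hamiltonian s D ϰ a J) t -
              (I.card : ℝ) * errTerm Sc ρ₁ ρ₂ ρ₃ ρ₄ (coefSup s D a J) (B10.pFun b₀ p₀ η) t) ≤
            ∫ z, cutoffBoltzmann (hamiltonian s D ϰ a J) I (B10.pFun b₀ p₀ η) z ∂μ →
        ∫ z, cutoffBoltzmann (hamiltonian s D ϰ a J) I (B10.pFun b₀ p₀ η) z ∂μ ≤
            Real.exp (cumulantSum μ (hamiltonian s D ϰ a J) t +
              (I.card : ℝ) * errTerm Sc ρ₁ ρ₂ ρ₃ ρ₄ (coefSup s D a J) (B10.pFun b₀ p₀ η) t) →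
        0 < ∫ z, cutoffBoltzmann (hamiltonian s D ϰ a J) I (B10.pFun b₀ p₀ η) z ∂μ ∧
          |Real.log (∫ z, cutoffBoltzmann (hamiltonian s D ϰ a J) I (B10.pFun b₀ p₀ η) z ∂μ) -
              cumulantSum μ (hamiltonian s D ϰ a J) t| ≤ C * η ^ κ * I.card := by
  obtain ⟨C, hC, hE⟩ := errTerm_pFun_le_on_unit ρ₁ ρ₂ ρ₄ t hS hρ₃ hb₀ hp₀ hσ hc hκ hκσ
  refine ⟨C, hC, fun η hη hη1 μ s I J a hA hlow hup => ?_⟩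
  obtain ⟨hpos, hsand⟩ := pos_and_abs_log_sub_le_of_sandwich hlow hup
  refine ⟨hpos, hsand.trans ?_⟩
  have herr := hE η (coefSup s D a J) hη hη1 (coefSup_nonneg s D a J) hA
  calc (I.card : ℝ) * errTerm Sc ρ₁ ρ₂ ρ₃ ρ₄ (coefSup s D a J) (B10.pFun b₀ p₀ η) t ≤ (I.card : ℝ) * (C * η ^ κ) :=
        mul_le_mul_of_nonneg_left herr (Nat.cast_nonneg _)
    _ = C * η ^ κ * I.card := by ring

/-- **… in `Eq324` form at the FREE moment-cumulant letter** (as part 1's `eq324Row_of_sandwich_consts`, on `(0, 1]`).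
[cite: Balaban1982Higgs1, (3.24) p.616; BenfattoEtAl1978, Lemma p.152] -/
theorem eq324Row_of_sandwich_on_unit {t D : ℕ} {ϰ Sc ρ₁ ρ₂ ρ₃ ρ₄ b₀ p₀ σ c κ : ℝ}
    (hS : 0 ≤ Sc) (hρ₃ : 0 < ρ₃) (hb₀ : 0 < b₀) (hp₀ : 2 / 3 < p₀) (hσ : 0 < σ) (hc : 0 ≤ c) (hκ : 0 < κ) (hκσ : κ < σ * (t + 1)) :
    ∃ C : ℝ, 0 ≤ C ∧ ∀ η : ℝ, 0 < η → η ≤ 1 →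
      ∀ (μ : Measure ((Fin d → ℤ) → ℝ)) (s : ℕ) (I J : Finset (Fin d → ℤ)) (a : Coef d), coefSup s D a J ≤ c * η ^ σ →
        Real.exp (cumulantSum μ (hamiltonian s D ϰ a J) t -
              (I.card : ℝ) * errTerm Sc ρ₁ ρ₂ ρ₃ ρ₄ (coefSup s D a J) (B10.pFun b₀ p₀ η) t) ≤
            ∫ z, cutoffBoltzmann (hamiltonian s D ϰ a J) I (B10.pFun b₀ p₀ η) z ∂μ →
        ∫ z, cutoffBoltzmann (hamiltonian s D ϰ a J) I (B10.pFun b₀ p₀ η) z ∂μ ≤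
            Real.exp (cumulantSum μ (hamiltonian s D ϰ a J) t +
              (I.card : ℝ) * errTerm Sc ρ₁ ρ₂ ρ₃ ρ₄ (coefSup s D a J) (B10.pFun b₀ p₀ η) t) →
        Eq324 (∫ z in smallFieldSet I (B10.pFun b₀ p₀ η), Real.exp (hamiltonian s D ϰ a J z) ∂μ)
          (fun n => truncatedExp μ (hamiltonian s D ϰ a J) n) t C η κ I.card := by
  obtain ⟨C, hC, h⟩ :=
    pos_and_abs_log_le_of_sandwich_on_unit (d := d) (D := D) (ϰ := ϰ) (ρ₁ := ρ₁) (ρ₂ := ρ₂) (ρ₄ := ρ₄) hS hρ₃ hb₀ hp₀ hσ hc hκ hκσ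
  refine ⟨C, hC, fun η hη hη1 μ s I J a hA hlow hup => ?_⟩
  obtain ⟨hpos, habs⟩ := h η hη hη1 μ s I J a hA hlow hup
  rw [integral_cutoffBoltzmann_eq_setIntegral'] at hpos habs
  rw [eq324_iff_abs_log_sub_le hpos]
  simpa only [cumulantSum] using habs

variable {N : ℕ} (𝔠 : AlphaConsts L N)

/-- ★★ **THE CLASS CONSUMER AT [B10]'s CURRENCIES AT EVERY RUN STEP.**  `∃ C ≥ 0` (class constants + `n̄, κ₀, σ, b₀, p₀`) such that for EVERY lattice approximation `S`, EVERY step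
`k ≤ K` (so `g_k ≤ g√ε₀ ≤ 1`, `Scales.gK_le_one`) and every volume factor `v` with `C·v ≤ Ca + Cc`: for any measure `μ` and instance with `sup|coeff| ≤ c₀·g_k^σ`, `|I| ≤ v·|T₁^{(k)}|`,
the sandwich at `b = p(g_k)` gives `Eq324 (∫ z in smallFieldSet I (p(g_k)), e^{H_J z} ∂μ) (ℰ_μᵀ(H_J;·)) 𝔠.nbar (𝔠.Ca + 𝔠.Cc) (Lᵏ·S.g0sq) (3 + 𝔠.κ₀) (S.sites k)` — no «deep ultraviolet»
restriction. [cite: Balaban1985UV3, (5) p.256 + (41) p.266 + (56)–(58) p.270; Balaban1982Higgs1, (3.24) p.616; BenfattoEtAl1978, Lemma p.152] -/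
theorem eq324Row_of_sandwich_allSteps {D : ℕ} {ϰ Sc ρ₁ ρ₂ ρ₃ ρ₄ b₀ p₀ σ c₀ : ℝ}
    (hS : 0 ≤ Sc) (hρ₃ : 0 < ρ₃) (hb₀ : 0 < b₀) (hp₀ : 2 / 3 < p₀) (hσ : 0 < σ) (hc₀ : 0 ≤ c₀) (hκσ : 6 + 2 * 𝔠.κ₀ < σ * (𝔠.nbar + 1)) :
    ∃ C : ℝ, 0 ≤ C ∧ ∀ (S : Scales L) (k : ℕ), k ≤ S.K → ∀ v : ℝ, C * v ≤ 𝔠.Ca + 𝔠.Cc →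
      ∀ (μ : Measure ((Fin d → ℤ) → ℝ)) (s : ℕ) (I J : Finset (Fin d → ℤ)) (a : Coef d),
        coefSup s D a J ≤ c₀ * S.gk k ^ σ → (I.card : ℝ) ≤ v * S.sites k →
        Real.exp (cumulantSum μ (hamiltonian s D ϰ a J) 𝔠.nbar -
              (I.card : ℝ) * errTerm Sc ρ₁ ρ₂ ρ₃ ρ₄ (coefSup s D a J) (B10.pFun b₀ p₀ (S.gk k)) 𝔠.nbar) ≤
            ∫ z, cutoffBoltzmann (hamiltonian s D ϰ a J) I (B10.pFun b₀ p₀ (S.gk k)) z ∂μ →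
        ∫ z, cutoffBoltzmann (hamiltonian s D ϰ a J) I (B10.pFun b₀ p₀ (S.gk k)) z ∂μ ≤
            Real.exp (cumulantSum μ (hamiltonian s D ϰ a J) 𝔠.nbar +
              (I.card : ℝ) * errTerm Sc ρ₁ ρ₂ ρ₃ ρ₄ (coefSup s D a J) (B10.pFun b₀ p₀ (S.gk k)) 𝔠.nbar) →
        Eq324 (∫ z in smallFieldSet I (B10.pFun b₀ p₀ (S.gk k)), Real.exp (hamiltonian s D ϰ a J z) ∂μ)
          (fun n => truncatedExp μ (hamiltonian s D ϰ a J) n) 𝔠.nbar (𝔠.Ca + 𝔠.Cc) ((L : ℝ) ^ k * S.g0sq) (3 + 𝔠.κ₀) (S.sites k) := by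
  obtain ⟨C, hC, h⟩ :=
    eq324Row_of_sandwich_on_unit (d := d) (t := 𝔠.nbar) (D := D) (ϰ := ϰ) (ρ₁ := ρ₁) (ρ₂ := ρ₂) (ρ₄ := ρ₄) (κ := 6 + 2 * 𝔠.κ₀)
      hS hρ₃ hb₀ hp₀ hσ hc₀ (by linarith [𝔠.κ₀_pos]) hκσ
  refine ⟨C, hC, fun S k hk v hCv μ s I J a hA hI hlow hup => ?_⟩
  have hg : 0 < S.gk k := gk_pos S k
  have hg1 : S.gk k ≤ 1 := gk_le_one S S.gK_le_one k hk
  refine eq324_mono (h (S.gk k) hg hg1 μ s I J a hA hlow hup) ?_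
  rw [gk_rpow_six_add]
  exact budget_le_vol hC (mul_pos (pow_pos (L_pos S) k) (g0sq_pos S)) (sites_nonneg S k) hI hCv

/-- **… at the record's `b₀ = 𝔠.b₀`, `p₀ = 𝔠.p₀` and print's coupling power `σ = 1`** (`5 + 2κ₀ < n̄`). [cite: Balaban1985UV3, (7) p.257 + (56)–(58) p.270] -/
theorem eq324Row_of_sandwich_allSteps_rec_one {D : ℕ} {ϰ Sc ρ₁ ρ₂ ρ₃ ρ₄ c₀ : ℝ}
    (hS : 0 ≤ Sc) (hρ₃ : 0 < ρ₃) (hc₀ : 0 ≤ c₀) (hn : 5 + 2 * 𝔠.κ₀ < 𝔠.nbar) :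
    ∃ C : ℝ, 0 ≤ C ∧ ∀ (S : Scales L) (k : ℕ), k ≤ S.K → ∀ v : ℝ, C * v ≤ 𝔠.Ca + 𝔠.Cc →
      ∀ (μ : Measure ((Fin d → ℤ) → ℝ)) (s : ℕ) (I J : Finset (Fin d → ℤ)) (a : Coef d),
        coefSup s D a J ≤ c₀ * S.gk k → (I.card : ℝ) ≤ v * S.sites k →
        Real.exp (cumulantSum μ (hamiltonian s D ϰ a J) 𝔠.nbar -
              (I.card : ℝ) * errTerm Sc ρ₁ ρ₂ ρ₃ ρ₄ (coefSup s D a J) (B10.pFun 𝔠.b₀ 𝔠.p₀ (S.gk k)) 𝔠.nbar) ≤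
            ∫ z, cutoffBoltzmann (hamiltonian s D ϰ a J) I (B10.pFun 𝔠.b₀ 𝔠.p₀ (S.gk k)) z ∂μ →
        ∫ z, cutoffBoltzmann (hamiltonian s D ϰ a J) I (B10.pFun 𝔠.b₀ 𝔠.p₀ (S.gk k)) z ∂μ ≤
            Real.exp (cumulantSum μ (hamiltonian s D ϰ a J) 𝔠.nbar +
              (I.card : ℝ) * errTerm Sc ρ₁ ρ₂ ρ₃ ρ₄ (coefSup s D a J) (B10.pFun 𝔠.b₀ 𝔠.p₀ (S.gk k)) 𝔠.nbar) →
        Eq324 (∫ z in smallFieldSet I (B10.pFun 𝔠.b₀ 𝔠.p₀ (S.gk k)), Real.exp (hamiltonian s D ϰ a J z) ∂μ)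
          (fun n => truncatedExp μ (hamiltonian s D ϰ a J) n) 𝔠.nbar (𝔠.Ca + 𝔠.Cc) ((L : ℝ) ^ k * S.g0sq) (3 + 𝔠.κ₀) (S.sites k) := by
  obtain ⟨C, hC, h⟩ :=
    eq324Row_of_sandwich_allSteps 𝔠 (d := d) (D := D) (ϰ := ϰ) (ρ₁ := ρ₁) (ρ₂ := ρ₂) (ρ₄ := ρ₄) (b₀ := 𝔠.b₀) (p₀ := 𝔠.p₀) (σ := 1)
      hS hρ₃ 𝔠.b₀_pos (by linarith [𝔠.two_lt_p₀]) one_pos hc₀ (by linarith)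
  refine ⟨C, hC, fun S k hk v hCv μ s I J a hA hI hlow hup => ?_⟩
  exact h S k hk v hCv μ s I J a (by rwa [Real.rpow_one]) hI hlow hup

end Consumer

/-! ## §3 THE PLUG AT EVERY RUN STEP (a.e. presentation; knit form under the window `b* < b₀`) -/

section Plug

variable {G : Type} [GaugeGroup G] [MeasurableSpace G] [HaarData G] (𝔊 : GroupModel G) (𝔠 : AlphaConsts L 𝔊.N) {d : ℕ}

/-- ★★★ **THE (α)-ROW `h324` FROM THE CLASS ROAD's SANDWICH AT EVERY RUN STEP, UNDER AN ALMOST-EVERYWHERE PRESENTATION.**  `∃ C ≥ 0` from the class constants and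
`(n̄, κ₀, σ, b₀, p₀)` alone such that for EVERY `S`, `𝔖`, EVERY `k ≤ S.K` and `v` with `C·v ≤ Ca + Cc`: a per-(h, U) presentation of the step block by members `μ h U`
(`(𝔖 k).μ = (μ h U).map (Φ h U)`, `(Φ h U)⁻¹'(box h) =ᵐ[μ h U] smallFieldSet (I h U) (p(g_k))`, `𝒱 h U ∘ Φ h U =ᵐ[μ h U] H_{J h U}`), the per-(h, U) sandwich at `b = p(g_k)`, `t = n̄`,
smallness `≤ c₀·g_k^σ` and `|I h U| ≤ v·|T₁^{(k)}|` give `StepAlphaEq324CoreLTAtAC.h324` ∕ `StepAlphaEq324CoreLTAt.h324` at the free letter (an EXACT presentation is the special case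
`Filter.EventuallyEq.of_eq`∕`ae_of_all`).
[cite: Balaban1985UV3, (41) p.266 + (56)–(58) p.270; Balaban1982Higgs1, (3.24) p.616; BenfattoEtAl1978, (2.7) p.147 + Lemma p.152 + (A.1) p.161] -/
theorem exists_h324Row_freeLetter_of_classSandwich_allSteps_ae {D : ℕ} {ϰ Sc ρ₁ ρ₂ ρ₃ ρ₄ b₀ p₀ σ c₀ : ℝ}
    (hS : 0 ≤ Sc) (hρ₃ : 0 < ρ₃) (hb₀ : 0 < b₀) (hp₀ : 2 / 3 < p₀) (hσ : 0 < σ) (hc₀ : 0 ≤ c₀) (hκσ : 6 + 2 * 𝔠.κ₀ < σ * (𝔠.nbar + 1)) :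
    ∃ C : ℝ, 0 ≤ C ∧
      ∀ (S : Scales L) (𝔖 : ∀ k, StepSeries S G ↥(lieC 𝔊) (nblkOf S 𝔠.lane.carrier k) k) (k : ℕ), k ≤ S.K → ∀ (v : ℝ), C * v ≤ 𝔠.Ca + 𝔠.Cc →
        ∀ (μ : Hist S.P (k + 1) → GaugeField S.P (k + 1) G → Measure ((Fin d → ℤ) → ℝ))
          (Φ : Hist S.P (k + 1) → GaugeField S.P (k + 1) G → ((Fin d → ℤ) → ℝ) → (𝔖 k).Fl)
          (s : ℕ) (I J : Hist S.P (k + 1) → GaugeField S.P (k + 1) G → Finset (Fin d → ℤ))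
          (a : Hist S.P (k + 1) → GaugeField S.P (k + 1) G → Coef d),
          (∀ h U, Measurable (Φ h U)) → (∀ h U, (𝔖 k).μ = (μ h U).map (Φ h U)) →
          (∀ h, MeasurableSet ((𝔖 k).box h)) → (∀ h U, Measurable ((𝔖 k).𝒱 h U)) →
          (∀ h U, Φ h U ⁻¹' (𝔖 k).box h =ᵐ[μ h U] smallFieldSet (I h U) (B10.pFun b₀ p₀ (S.gk k))) →
          (∀ h U, (fun z => (𝔖 k).𝒱 h U (Φ h U z)) =ᵐ[μ h U] hamiltonian s D ϰ (a h U) (J h U)) →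
          (∀ h U, coefSup s D (a h U) (J h U) ≤ c₀ * S.gk k ^ σ) →
          (∀ h U, ((I h U).card : ℝ) ≤ v * S.sites k) →
          (∀ h U, Real.exp (cumulantSum (μ h U) (hamiltonian s D ϰ (a h U) (J h U)) 𝔠.nbar -
                ((I h U).card : ℝ) * errTerm Sc ρ₁ ρ₂ ρ₃ ρ₄ (coefSup s D (a h U) (J h U)) (B10.pFun b₀ p₀ (S.gk k)) 𝔠.nbar) ≤
              ∫ z, cutoffBoltzmann (hamiltonian s D ϰ (a h U) (J h U)) (I h U) (B10.pFun b₀ p₀ (S.gk k)) z ∂μ h U) →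
          (∀ h U, ∫ z, cutoffBoltzmann (hamiltonian s D ϰ (a h U) (J h U)) (I h U) (B10.pFun b₀ p₀ (S.gk k)) z ∂μ h U ≤
              Real.exp (cumulantSum (μ h U) (hamiltonian s D ϰ (a h U) (J h U)) 𝔠.nbar +
                ((I h U).card : ℝ) * errTerm Sc ρ₁ ρ₂ ρ₃ ρ₄ (coefSup s D (a h U) (J h U)) (B10.pFun b₀ p₀ (S.gk k)) 𝔠.nbar)) →
          ∀ h (U : GaugeField S.P (k + 1) G),
            Eq324 (∫ ω in (𝔖 k).box h, Real.exp ((𝔖 k).𝒱 h U ω) ∂(𝔖 k).μ)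
              (fun n => cumulantOf (fun m => ∫ ω, (𝔖 k).𝒱 h U ω ^ m ∂(𝔖 k).μ) n) 𝔠.nbar (𝔠.Ca + 𝔠.Cc)
              ((L : ℝ) ^ k * S.g0sq) (3 + 𝔠.κ₀) (S.sites k) := by
  obtain ⟨C, hC, h⟩ :=
    eq324Row_of_sandwich_allSteps 𝔠 (d := d) (D := D) (ϰ := ϰ) (ρ₁ := ρ₁) (ρ₂ := ρ₂) (ρ₄ := ρ₄) hS hρ₃ hb₀ hp₀ hσ hc₀ hκσ
  refine ⟨C, hC, fun S 𝔖 k hk v hCv μ Φ s I J a hΦ hμ hboxm hVm hbox hV hA hI hlow hup => ?_⟩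
  exact h324RowAt_freeLetter_of_latticePresentation_ae 𝔊 𝔠 𝔖 k μ Φ hΦ hμ hboxm hVm I (fun _ _ => B10.pFun b₀ p₀ (S.gk k)) hbox
    (fun h U => hamiltonian s D ϰ (a h U) (J h U)) hV
    (fun h' U => h S k hk v hCv (μ h' U) s (I h' U) (J h' U) (a h' U) (hA h' U) (hI h' U) (hlow h' U) (hup h' U))

/-- **… WITH THE SANDWICH IN KNIT FORM `∀ b > b*`, UNDER THE THRESHOLD WINDOW `b* < b₀`** (then `b* < p(g_k)` at every step `k ≤ K`, `lt_pFun_of_lt_b₀`), a.e. presentation.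
[cite: Balaban1985UV3, (7) p.257 + (41) p.266 + (58) p.270; BenfattoEtAl1978, Lemma p.152 + b* p.159] -/
theorem exists_h324Row_freeLetter_of_classSandwich_allSteps_of_forall_gt_ae {D : ℕ} {ϰ bstar Sc ρ₁ ρ₂ ρ₃ ρ₄ b₀ p₀ σ c₀ : ℝ}
    (hS : 0 ≤ Sc) (hρ₃ : 0 < ρ₃) (hb₀ : 0 < b₀) (hp₀ : 2 / 3 < p₀) (hσ : 0 < σ) (hc₀ : 0 ≤ c₀) (hκσ : 6 + 2 * 𝔠.κ₀ < σ * (𝔠.nbar + 1))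
    (hbw : bstar < b₀) :
    ∃ C : ℝ, 0 ≤ C ∧
      ∀ (S : Scales L) (𝔖 : ∀ k, StepSeries S G ↥(lieC 𝔊) (nblkOf S 𝔠.lane.carrier k) k) (k : ℕ), k ≤ S.K → ∀ (v : ℝ), C * v ≤ 𝔠.Ca + 𝔠.Cc →
        ∀ (μ : Hist S.P (k + 1) → GaugeField S.P (k + 1) G → Measure ((Fin d → ℤ) → ℝ))
          (Φ : Hist S.P (k + 1) → GaugeField S.P (k + 1) G → ((Fin d → ℤ) → ℝ) → (𝔖 k).Fl)
          (s : ℕ) (I J : Hist S.P (k + 1) → GaugeField S.P (k + 1) G → Finset (Fin d → ℤ))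
          (a : Hist S.P (k + 1) → GaugeField S.P (k + 1) G → Coef d),
          (∀ h U, Measurable (Φ h U)) → (∀ h U, (𝔖 k).μ = (μ h U).map (Φ h U)) →
          (∀ h, MeasurableSet ((𝔖 k).box h)) → (∀ h U, Measurable ((𝔖 k).𝒱 h U)) →
          (∀ h U, Φ h U ⁻¹' (𝔖 k).box h =ᵐ[μ h U] smallFieldSet (I h U) (B10.pFun b₀ p₀ (S.gk k))) →
          (∀ h U, (fun z => (𝔖 k).𝒱 h U (Φ h U z)) =ᵐ[μ h U] hamiltonian s D ϰ (a h U) (J h U)) →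
          (∀ h U, coefSup s D (a h U) (J h U) ≤ c₀ * S.gk k ^ σ) →
          (∀ h U, ((I h U).card : ℝ) ≤ v * S.sites k) →
          (∀ h U (b : ℝ), bstar < b →
            Real.exp (cumulantSum (μ h U) (hamiltonian s D ϰ (a h U) (J h U)) 𝔠.nbar -
                  ((I h U).card : ℝ) * errTerm Sc ρ₁ ρ₂ ρ₃ ρ₄ (coefSup s D (a h U) (J h U)) b 𝔠.nbar) ≤
                ∫ z, cutoffBoltzmann (hamiltonian s D ϰ (a h U) (J h U)) (I h U) b z ∂μ h U ∧
              ∫ z, cutoffBoltzmann (hamiltonian s D ϰ (a h U) (J h U)) (I h U) b z ∂μ h U ≤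
                Real.exp (cumulantSum (μ h U) (hamiltonian s D ϰ (a h U) (J h U)) 𝔠.nbar +
                  ((I h U).card : ℝ) * errTerm Sc ρ₁ ρ₂ ρ₃ ρ₄ (coefSup s D (a h U) (J h U)) b 𝔠.nbar)) →
          ∀ h (U : GaugeField S.P (k + 1) G),
            Eq324 (∫ ω in (𝔖 k).box h, Real.exp ((𝔖 k).𝒱 h U ω) ∂(𝔖 k).μ)
              (fun n => cumulantOf (fun m => ∫ ω, (𝔖 k).𝒱 h U ω ^ m ∂(𝔖 k).μ) n) 𝔠.nbar (𝔠.Ca + 𝔠.Cc)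
              ((L : ℝ) ^ k * S.g0sq) (3 + 𝔠.κ₀) (S.sites k) := by
  obtain ⟨C, hC, h⟩ :=
    exists_h324Row_freeLetter_of_classSandwich_allSteps_ae 𝔊 𝔠 (d := d) (D := D) (ϰ := ϰ) (ρ₁ := ρ₁) (ρ₂ := ρ₂) (ρ₄ := ρ₄)
      hS hρ₃ hb₀ hp₀ hσ hc₀ hκσ
  refine ⟨C, hC, fun S 𝔖 k hk v hCv μ Φ s I J a hΦ hμ hboxm hVm hbox hV hA hI hknit => ?_⟩
  have hb : bstar < B10.pFun b₀ p₀ (S.gk k) :=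
    lt_pFun_of_lt_b₀ hbw hb₀ (by linarith) (gk_pos S k) (gk_le_one S S.gK_le_one k hk)
  exact h S 𝔖 k hk v hCv μ Φ s I J a hΦ hμ hboxm hVm hbox hV hA hI (fun h' U => (hknit h' U _ hb).1) (fun h' U => (hknit h' U _ hb).2)

/-- **… AT THE RECORD's OWN `b₀, p₀` AND `σ = 1`, UNDER THE WINDOW `b* < 𝔠.b₀`**, knit form, a.e. presentation, every run step.
[cite: Balaban1985UV3, (7) p.257 + (41) p.266 + (56)–(58) p.270; Balaban1982Higgs1, (3.24) p.616; BenfattoEtAl1978, Lemma p.152 + b* p.159] -/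
theorem exists_h324Row_freeLetter_of_classSandwich_allSteps_rec_one_ae {D : ℕ} {ϰ bstar Sc ρ₁ ρ₂ ρ₃ ρ₄ c₀ : ℝ}
    (hS : 0 ≤ Sc) (hρ₃ : 0 < ρ₃) (hc₀ : 0 ≤ c₀) (hn : 5 + 2 * 𝔠.κ₀ < 𝔠.nbar) (hbw : bstar < 𝔠.b₀) :
    ∃ C : ℝ, 0 ≤ C ∧
      ∀ (S : Scales L) (𝔖 : ∀ k, StepSeries S G ↥(lieC 𝔊) (nblkOf S 𝔠.lane.carrier k) k) (k : ℕ), k ≤ S.K → ∀ (v : ℝ), C * v ≤ 𝔠.Ca + 𝔠.Cc →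
        ∀ (μ : Hist S.P (k + 1) → GaugeField S.P (k + 1) G → Measure ((Fin d → ℤ) → ℝ))
          (Φ : Hist S.P (k + 1) → GaugeField S.P (k + 1) G → ((Fin d → ℤ) → ℝ) → (𝔖 k).Fl)
          (s : ℕ) (I J : Hist S.P (k + 1) → GaugeField S.P (k + 1) G → Finset (Fin d → ℤ))
          (a : Hist S.P (k + 1) → GaugeField S.P (k + 1) G → Coef d),
          (∀ h U, Measurable (Φ h U)) → (∀ h U, (𝔖 k).μ = (μ h U).map (Φ h U)) →
          (∀ h, MeasurableSet ((𝔖 k).box h)) → (∀ h U, Measurable ((𝔖 k).𝒱 h U)) →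
          (∀ h U, Φ h U ⁻¹' (𝔖 k).box h =ᵐ[μ h U] smallFieldSet (I h U) (B10.pFun 𝔠.b₀ 𝔠.p₀ (S.gk k))) →
          (∀ h U, (fun z => (𝔖 k).𝒱 h U (Φ h U z)) =ᵐ[μ h U] hamiltonian s D ϰ (a h U) (J h U)) →
          (∀ h U, coefSup s D (a h U) (J h U) ≤ c₀ * S.gk k) →
          (∀ h U, ((I h U).card : ℝ) ≤ v * S.sites k) →
          (∀ h U (b : ℝ), bstar < b →
            Real.exp (cumulantSum (μ h U) (hamiltonian s D ϰ (a h U) (J h U)) 𝔠.nbar -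
                  ((I h U).card : ℝ) * errTerm Sc ρ₁ ρ₂ ρ₃ ρ₄ (coefSup s D (a h U) (J h U)) b 𝔠.nbar) ≤
                ∫ z, cutoffBoltzmann (hamiltonian s D ϰ (a h U) (J h U)) (I h U) b z ∂μ h U ∧
              ∫ z, cutoffBoltzmann (hamiltonian s D ϰ (a h U) (J h U)) (I h U) b z ∂μ h U ≤
                Real.exp (cumulantSum (μ h U) (hamiltonian s D ϰ (a h U) (J h U)) 𝔠.nbar +
                  ((I h U).card : ℝ) * errTerm Sc ρ₁ ρ₂ ρ₃ ρ₄ (coefSup s D (a h U) (J h U)) b 𝔠.nbar)) →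
          ∀ h (U : GaugeField S.P (k + 1) G),
            Eq324 (∫ ω in (𝔖 k).box h, Real.exp ((𝔖 k).𝒱 h U ω) ∂(𝔖 k).μ)
              (fun n => cumulantOf (fun m => ∫ ω, (𝔖 k).𝒱 h U ω ^ m ∂(𝔖 k).μ) n) 𝔠.nbar (𝔠.Ca + 𝔠.Cc)
              ((L : ℝ) ^ k * S.g0sq) (3 + 𝔠.κ₀) (S.sites k) := by
  obtain ⟨C, hC, h⟩ :=
    exists_h324Row_freeLetter_of_classSandwich_allSteps_of_forall_gt_ae 𝔊 𝔠 (d := d) (D := D) (ϰ := ϰ) (bstar := bstar) (ρ₁ := ρ₁) (ρ₂ := ρ₂)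
      (ρ₄ := ρ₄) (b₀ := 𝔠.b₀) (p₀ := 𝔠.p₀) (σ := 1) hS hρ₃ 𝔠.b₀_pos (by linarith [𝔠.two_lt_p₀]) one_pos hc₀ (by linarith) hbw
  refine ⟨C, hC, fun S 𝔖 k hk v hCv μ Φ s I J a hΦ hμ hboxm hVm hbox hV hA hI hknit => ?_⟩
  exact h S 𝔖 k hk v hCv μ Φ s I J a hΦ hμ hboxm hVm hbox hV (fun h' U => by rw [Real.rpow_one]; exact hA h' U) hI hknit

end Plug

end Summit.QuantumFields.YangMills.Theorems.BalabanUVNodesN08AlphaEq324RowClassSocketAllSteps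

end
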